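import Literature.MathematicalPhysics.QuantumFieldTheory.Balaban1983to89.B1Lemma21RegularRegion

/-!
# `Balaban1983to89.B1TorusRegionRop` — [Balaban1983RegularityDecay] (2.11)–(2.13) pp. 576–577 and «the L₂-norm of the operator R … is small
# for M large enough, so the series in the representation (2.12) is convergent» (p. 577) FOR A BIG-BLOCK REGION `Ω ⊂ T_ε` ON THE (Higgs)₂,₃
# CARRIER: the letters of (2.2)/(2.11) PROJECTED onto the fields supported in `Ω` (the printed operator acts «on functions φ : Ω → R^N»), the
# identity `G·1_Ω = G₀·1_Ω + (G·1_Ω)(R·1_Ω)`, their locality, and the `L²` smallness `‖R·1_Ω‖_{2,2} ≤ 2^d·β` with the Neumann tail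
# `(G·1_Ω)(R·1_Ω)^m → 0`

statement-level skeleton of published theorems with citation tags; proofs where landed; nothing here is a claim about the Yang–Mills mass gap

PDF held: `paper:balaban1983-cmp89-regularity-decay` pp. 576–579 [PDF 6–9] (text layer re-read by this seat); `paper:balaban1982-cmp85-higgs23-i`
p. 610 [PDF 8].

CITATION HEADER (lean-in-tree rule).  T. Bałaban, *Regularity and decay of lattice Green's functions*, Commun. Math. Phys. **89** (1983)
571–597 [Balaban1983RegularityDecay] ((2.11)–(2.13) pp. 576–577, p. 577 «convergent in this norm», (2.22) p. 579) and T. Bałaban, *(Higgs)₂,₃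
quantum fields in a finite volume. I*, Commun. Math. Phys. **85** (1982) 603–626 [Balaban1982Higgs1] ((2.20), Prop. 2.1 p. 610).  Cell
`lit-balaban` (HOME `run/shared/lean/pub/lit-balaban/`), Phase-2 proof seat **p35** gen 12 (unit `lit-balaban-p35`); SKELETON rows **B4.Eq2.11**,
**B4.Eq2.12**, **B4.Eq2.13** (model instances for regions of `T_ε` on the (Higgs)₂,₃ carrier), feeding **B1.Prop2.1**.  USED BY NAME, never
restated: this seat's `B1TorusRegionCubes` (`aOp`, `bOp`, `G0`, `Rop`, `mulOp`, `propagatorK_eq_G0_add`, `aOp_mul_bOp_eq_zero`,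
`bOp_mul_bOp_eq_zero`, `bOp_apply_eq_zero_off`, `bOp_apply_eq_zero_of`, `card_filter_near_rS_le`, `piece_blockSat`),
`B1Lemma21RegularRegion` (`covOpK_comm_eq`, `covLaplacianN_comm_apply`, `projPk_comm_apply`, `hTor_smul_supported_piece`,
`sNorm_le_of_norm_le`, `sNorm_le_sqrt`), r14's `B1Cor23RegularRegion.propagatorK_supported`, the typer's `HiggsCovarianceCont`
(`sqrt_mul_norm_apply_le`, `msq_mul_sNorm_propagatorK_le`).

WHAT IS PRINTED.  p. 576–577: *«R = Σ_j K_jG_k(□_j, A_j)h_j (2.11) … G_k(Ω, A) = G₀(I − R)⁻¹ = Σ_{n=0}^∞ G₀Rⁿ (2.12) … (2.13) and this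
representation follows from (2.12) and the obvious fact that h_ih_j = 0 if |i − j| > 1»*; p. 577: *«Let us notice that Lemma 2.1 implies that
the L₂-norm of the operator R given by (2.11) is small for M large enough, so the series in the representation (2.12) is convergent in this
norm.»*; [B1] p. 610: *«G_k(Ω, A) … on functions φ : Ω → R^N»*.

WHAT THIS FILE PROVES (kernel-checked, zero `sorry`; definitions with bodies + theorems; no `Prop` fact).
* §1 `chi Ω` (the indicator of `Ω` as a multiplier), `chi_smul_apply`, `chi_smul_supported`, `chi_smul_eq_self`, `norm_chi_smul_le`,
  `sNorm_chi_smul_le`; the PROJECTED LETTERS `aOpP = a_j·1_Ω`, `bOpP = b_j·1_Ω`, `GP = G^ε_K(Ω,A)·1_Ω`, `G0P`, `RopP` (`= Σ` of the letters).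
* §2 SUPPORT: **`bOp_chi_apply_eq_zero`** — `b_j(1_Ωg)` is supported in `Ω` (`Ω` a union of `K`-blocks: off `Ω` the Neumann bonds of the piece
  are absent and the block average of (2.20) sees only the block of `x`, disjoint from `Ω`), hence `mulOp_chi_bOp` (`1_Ω b_j 1_Ω = b_j 1_Ω`),
  `aOp_chi_apply_eq_zero`, `mulOp_chi_Rop`.
* §3 **`GP_eq`** — THE IDENTITY (2.12) FOR THE PROJECTED SYSTEM: `G·1_Ω = G₀·1_Ω + (G·1_Ω)(R·1_Ω)` in `Module.End`; LOCALITY (2.13):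
  `aOpP_mul_bOpP_eq_zero`, `bOpP_mul_bOpP_eq_zero` for labels with disjoint `rS`-cores.
* §4 **THE `L²` SMALLNESS OF `R` ON `Ω`** (p. 577): `norm_sq_sum_le_card_mul` (Cauchy–Schwarz), `bOp_eq_bOp_nearCut` (the letter reads its
  input on the `rS`-core only), **`sNorm_Rop_le`**: if every letter satisfies `‖b_jφ‖₂ ≤ β‖φ‖₂` on `Ω`-supported `φ`, then
  `‖R φ‖₂ ≤ 2^d·β·‖φ‖₂` for `Ω`-supported `φ` (at most `2^d` cores meet at a site, twice); **`sNorm_RopP_pow_le`** (`‖(R1_Ω)^m g‖₂ ≤ (2^dβ)^m‖g‖₂`),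
  **`norm_GP_RopP_pow_apply_le`** and **`exists_tail_le`**: `|((G1_Ω)(R1_Ω)^m g)(x)| ≤ ε^{−d/2}m⁻²(2^dβ)^m‖g‖₂ → 0` when `2^dβ < 1` — the
  remainder hypothesis `hrem` of r01's `B4Ineq110LpChain.lp_walk_bound_rem_exp`.
HONEST SCOPE.  Algebra and `L²` bookkeeping for the projected letters only; the letter bound `β` is a hypothesis here (discharged at boundary
pieces by `B1Lemma21RegularRegion.sNorm_bOp_le_of_bad` and at interior cubes by `B1TorusCubeLpInput`); `Ω` a union of `K`-blocks; `m² > 0`.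
Unit `lit-balaban-p35` gen 12 (literature-prover-lit-balaban-p35-g12-0).
-/

open scoped BigOperators

noncomputable section

namespace Literature.MathematicalPhysics.QuantumFieldTheory.Balaban1983to89.B1TorusRegionRop

open Literature.MathematicalPhysics.QuantumFieldTheory.Balaban1983to89.HiggsLattice
open Literature.MathematicalPhysics.QuantumFieldTheory.Balaban1983to89.HiggsAveraging
open Literature.MathematicalPhysics.QuantumFieldTheory.Balaban1983to89.HiggsCovariance
open Literature.MathematicalPhysics.QuantumFieldTheory.Balaban1983to89.HiggsCovariancePos
open Literature.MathematicalPhysics.QuantumFieldTheory.Balaban1983to89.HiggsCovarianceCont (sNorm sNorm_nonneg sNorm_sq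
  sNorm_add_le sNorm_smul sqrt_mul_norm_apply_le msq_mul_sNorm_propagatorK_le)
open Literature.MathematicalPhysics.QuantumFieldTheory.Balaban1983to89.B1Cor23RegularRegion (propagatorK_supported)
open Literature.MathematicalPhysics.QuantumFieldTheory.Balaban1983to89.B1TorusCubeCover
open Literature.MathematicalPhysics.QuantumFieldTheory.Balaban1983to89.B1TorusCubeLocality26
open Literature.MathematicalPhysics.QuantumFieldTheory.Balaban1983to89.B1TorusRegionCubes
open Literature.MathematicalPhysics.QuantumFieldTheory.Balaban1983to89.B1Lemma21RegularRegion

variable {P : HiggsLattice.Params} {N : ℕ}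

/-! ## §1 The indicator of `Ω` and the projected letters -/

section Indicator

/-- The indicator of `Ω` as a real multiplier on `T_ε`. [cite: Balaban1982Higgs1, (2.20) p.610 «on functions φ : Ω → R^N»] -/
def chi (Ω : Finset (HiggsLattice.Site P 0)) : HiggsLattice.Site P 0 → ℝ := fun x => if x ∈ Ω then 1 else 0

variable (Ω : Finset (HiggsLattice.Site P 0))

/-- `(1_Ωψ)(x) = ψ(x)` on `Ω` and `0` off `Ω`. [cite: Balaban1982Higgs1, (2.20) p.610] -/
theorem chi_smul_apply (ψ : ScalarField P 0 N) (x : HiggsLattice.Site P 0) :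
    (chi Ω • ψ) x = if x ∈ Ω then ψ x else 0 := by
  rw [Pi.smul_apply']
  unfold chi
  split_ifs <;> simp

/-- `1_Ωψ` is supported in `Ω`. [cite: Balaban1982Higgs1, (2.20) p.610] -/
theorem chi_smul_supported (ψ : ScalarField P 0 N) : ∀ x, x ∉ Ω → (chi Ω • ψ) x = 0 :=
  fun x hx => by rw [chi_smul_apply, if_neg hx]

/-- `1_Ωψ = ψ` for `ψ` supported in `Ω`. [cite: Balaban1982Higgs1, (2.20) p.610] -/
theorem chi_smul_eq_self {ψ : ScalarField P 0 N} (hψ : ∀ x, x ∉ Ω → ψ x = 0) : chi Ω • ψ = ψ := by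
  funext x
  rw [chi_smul_apply]
  split_ifs with hx
  · rfl
  · exact (hψ x hx).symm

/-- `|(1_Ωψ)(x)| ≤ |ψ(x)|`. [cite: Balaban1982Higgs1, (2.20) p.610] -/
theorem norm_chi_smul_apply_le (ψ : ScalarField P 0 N) (x : HiggsLattice.Site P 0) : ‖(chi Ω • ψ) x‖ ≤ ‖ψ x‖ := by
  rw [chi_smul_apply]
  split_ifs
  · exact le_rfl
  · rw [norm_zero]; exact norm_nonneg _

/-- `‖1_Ωψ‖_∞ ≤ ‖ψ‖_∞`. [cite: Balaban1982Higgs1, (2.20) p.610] -/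
theorem norm_chi_smul_le (ψ : ScalarField P 0 N) : ‖chi Ω • ψ‖ ≤ ‖ψ‖ :=
  (pi_norm_le_iff_of_nonneg (norm_nonneg ψ)).2 fun x => (norm_chi_smul_apply_le Ω ψ x).trans (norm_le_pi_norm ψ x)

/-- `‖1_Ωψ‖₂ ≤ ‖ψ‖₂`. [cite: Balaban1982Higgs1, (1.5) p.604] -/
theorem sNorm_chi_smul_le (ψ : ScalarField P 0 N) : sNorm (chi Ω • ψ) ≤ sNorm ψ := by
  have h := sNorm_le_of_norm_le (f := chi Ω • ψ) (g := ψ) zero_le_one fun x => by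
    rw [one_mul]; exact norm_chi_smul_apply_le Ω ψ x
  rwa [one_mul] at h

end Indicator

section Letters

variable (C : ChargeData N) (K K₀ : ℕ) (Ω : Finset (HiggsLattice.Site P 0)) (A : HiggsLattice.VecField P 0) (msq a : ℝ)

/-- THE PROJECTED LETTER `a_j·1_Ω = h_jG_k(□_j, A_j)h_j·1_Ω`. [cite: Balaban1983RegularityDecay, (2.2) p.575] -/
def aOpP (j : Lab P K K₀) : Module.End ℝ (HiggsLattice.ScalarField P 0 N) :=
  aOp C K K₀ Ω A msq a j * mulOp (N := N) (chi Ω)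

/-- THE PROJECTED LETTER `b_j·1_Ω = −K_jG_k(□_j, A_j)h_j·1_Ω`. [cite: Balaban1983RegularityDecay, (2.11) p.576] -/
def bOpP (j : Lab P K K₀) : Module.End ℝ (HiggsLattice.ScalarField P 0 N) :=
  bOp C K K₀ Ω A msq a j * mulOp (N := N) (chi Ω)

/-- `G₀·1_Ω`. [cite: Balaban1983RegularityDecay, (2.2) p.575] -/
def G0P : Module.End ℝ (HiggsLattice.ScalarField P 0 N) := G0 C K K₀ Ω A msq a * mulOp (N := N) (chi Ω)

/-- `R·1_Ω`. [cite: Balaban1983RegularityDecay, (2.11) p.576] -/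
def RopP : Module.End ℝ (HiggsLattice.ScalarField P 0 N) := Rop C K K₀ Ω A msq a * mulOp (N := N) (chi Ω)

/-- `G^ε_K(Ω, A)·1_Ω` — the printed propagator «on functions φ : Ω → R^N». [cite: Balaban1982Higgs1, (2.20) p.610] -/
def GP : Module.End ℝ (HiggsLattice.ScalarField P 0 N) := propagatorK C Ω A msq a K * mulOp (N := N) (chi Ω)

variable {C K K₀ Ω A msq a}

/-- `G₀·1_Ω = Σ_j a_j·1_Ω`. [cite: Balaban1983RegularityDecay, (2.2) p.575] -/
theorem G0P_eq_sum : G0P C K K₀ Ω A msq a = ∑ j : Lab P K K₀, aOpP C K K₀ Ω A msq a j := by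
  unfold G0P aOpP G0
  rw [Finset.sum_mul]

/-- `R·1_Ω = Σ_j b_j·1_Ω`. [cite: Balaban1983RegularityDecay, (2.11) p.576] -/
theorem RopP_eq_sum : RopP C K K₀ Ω A msq a = ∑ j : Lab P K K₀, bOpP C K K₀ Ω A msq a j := by
  unfold RopP bOpP Rop
  rw [Finset.sum_mul]

/-- `(a_j·1_Ω)g = a_j(1_Ωg)`. [cite: Balaban1983RegularityDecay, (2.2) p.575] -/
theorem aOpP_apply (j : Lab P K K₀) (g : ScalarField P 0 N) :
    aOpP C K K₀ Ω A msq a j g = aOp C K K₀ Ω A msq a j (chi Ω • g) := rfl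

/-- `(b_j·1_Ω)g = b_j(1_Ωg)`. [cite: Balaban1983RegularityDecay, (2.11) p.576] -/
theorem bOpP_apply (j : Lab P K K₀) (g : ScalarField P 0 N) :
    bOpP C K K₀ Ω A msq a j g = bOp C K K₀ Ω A msq a j (chi Ω • g) := rfl

/-- `(R·1_Ω)g = R(1_Ωg)`. [cite: Balaban1983RegularityDecay, (2.11) p.576] -/
theorem RopP_apply (g : ScalarField P 0 N) : RopP C K K₀ Ω A msq a g = Rop C K K₀ Ω A msq a (chi Ω • g) := rfl

/-- `(G·1_Ω)g = G(1_Ωg)`. [cite: Balaban1982Higgs1, (2.20) p.610] -/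
theorem GP_apply (g : ScalarField P 0 N) : GP C K Ω A msq a g = propagatorK C Ω A msq a K (chi Ω • g) := rfl

end Letters

/-! ## §2 The letters map `Ω`-supported fields to `Ω`-supported fields -/

section Support

variable (C : ChargeData N) {K K₀ : ℕ} (Ω : Finset (HiggsLattice.Site P 0)) (A : HiggsLattice.VecField P 0) {msq a : ℝ}

/-- **`b_j(1_Ωg)` IS SUPPORTED IN `Ω`** (`Ω` a union of `K`-blocks, `K ≤ K_P`, `K₀ ∣ M_P`, `K₀ ≥ 8`, `3M ≤ |T_ε|_μ`, `m² > 0`, `a_K ≥ 0`): with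
`v = G_j(h_j1_Ωg)` supported in the piece `Ω ∩ □_j`, at a site `x ∉ Ω` the Neumann bonds of the piece are absent, the mass terms cancel, and
the block average `[P_K(A_j), h_j]v` sees only the `K`-block of `x`, which misses `Ω`. [cite: Balaban1983RegularityDecay, (2.10)–(2.11) p.576]
[cite: Balaban1982Higgs1, (2.20) p.610] -/
theorem bOp_chi_apply_eq_zero (hK : K ≤ P.K) (hK₀ : K₀ ∣ P.M) (hK₀8 : 8 ≤ K₀) (hN3 : ∀ μ, 3 * half P K K₀ ≤ P.sitesPerDir 0 μ)
    (hΩ : ∀ x x' : HiggsLattice.Site P 0, blockIter K x = blockIter K x' → (x ∈ Ω ↔ x' ∈ Ω))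
    (hmsq : 0 < msq) (hak : 0 ≤ B1.aSeq a P.L K) (j : Lab P K K₀) (g : ScalarField P 0 N)
    {x : HiggsLattice.Site P 0} (hx : x ∉ Ω) :
    bOp C K K₀ Ω A msq a j (chi Ω • g) x = 0 := by
  have hK₀' : 1 ≤ K₀ := le_trans (by norm_num) hK₀8
  have hP := piece_blockSat hK hK₀ hK₀' hN3 hΩ j
  set ψ := chi Ω • g with hψdef
  have hψΩ : ∀ y, y ∉ Ω → ψ y = 0 := chi_smul_supported Ω g
  set v := Gloc C K K₀ Ω A msq a j (hTor K K₀ j • ψ) with hv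
  have hvsupp : ∀ y, y ∉ piece K K₀ Ω j → v y = 0 :=
    propagatorK_supported C (piece K K₀ Ω j) (fld K K₀ Ω A j) hmsq hak hP (hTor K K₀ j • ψ)
      (hTor_smul_supported_piece hK hK₀ hK₀8 Ω j ψ hψΩ)
  have hxp : x ∉ piece K K₀ Ω j := fun h => hx (piece_subset Ω j h)
  rw [bOp_apply, Pi.neg_apply, neg_eq_zero]
  show (covOpK C (piece K K₀ Ω j) (fld K K₀ Ω A j) msq a K (hTor K K₀ j • v)
    - hTor K K₀ j • covOpK C (piece K K₀ Ω j) (fld K K₀ Ω A j) msq a K v) x = 0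
  rw [covOpK_comm_eq, Pi.add_apply, Pi.smul_apply, covLaplacianN_comm_apply, projPk_comm_apply]
  -- the Laplacian part: no bond of the piece at `x`, and `v x = 0`
  have hL : ∀ μ : Fin P.d, fwdTerm C (piece K K₀ Ω j) (fld K K₀ Ω A j) x μ v = 0 ∧
      bwdTerm C (piece K K₀ Ω j) (fld K K₀ Ω A j) x μ v = 0 := fun μ => by
    constructor
    · rw [fwdTerm_apply, if_neg (fun h => hxp h.1)]
    · rw [bwdTerm_apply, if_neg (fun h => hxp h.1)]
  have h1 : ∑ μ : Fin P.d, ((hTor K K₀ j x - hTor K K₀ j (x.shift μ)) • fwdTerm C (piece K K₀ Ω j) (fld K K₀ Ω A j) x μ v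
      + (hTor K K₀ j x - hTor K K₀ j (x.unshift μ)) • bwdTerm C (piece K K₀ Ω j) (fld K K₀ Ω A j) x μ v) = 0 :=
    Finset.sum_eq_zero fun μ _ => by rw [(hL μ).1, (hL μ).2, smul_zero, smul_zero, add_zero]
  -- the block-average part: the `K`-block of `x` misses the piece
  have h2 : ∑ x' ∈ blockK K (blockIter K x), C.U (P.mesh 0) (multiContourSum (fld K K₀ Ω A j) K x')
      ((hTor K K₀ j x' - hTor K K₀ j x) • v x') = 0 := by
    refine Finset.sum_eq_zero fun x' hx' => ?_
    have hb : blockIter K x' = blockIter K x := (mem_blockK K _ x').1 hx'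
    have hx'p : x' ∉ piece K K₀ Ω j := fun h => hxp ((hP x' x hb).1 h)
    rw [hvsupp x' hx'p, smul_zero, map_zero]
  rw [h1, hvsupp x hxp, smul_zero, sub_zero, smul_zero, h2, smul_zero, map_zero, smul_zero, add_zero]

/-- Hence **`1_Ω·b_j·1_Ω = b_j·1_Ω`** in `Module.End`. [cite: Balaban1983RegularityDecay, (2.11) p.576] -/
theorem mulOp_chi_bOp (hK : K ≤ P.K) (hK₀ : K₀ ∣ P.M) (hK₀8 : 8 ≤ K₀) (hN3 : ∀ μ, 3 * half P K K₀ ≤ P.sitesPerDir 0 μ)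
    (hΩ : ∀ x x' : HiggsLattice.Site P 0, blockIter K x = blockIter K x' → (x ∈ Ω ↔ x' ∈ Ω))
    (hmsq : 0 < msq) (hak : 0 ≤ B1.aSeq a P.L K) (j : Lab P K K₀) :
    mulOp (N := N) (chi Ω) * bOp C K K₀ Ω A msq a j * mulOp (N := N) (chi Ω)
      = bOp C K K₀ Ω A msq a j * mulOp (N := N) (chi Ω) := by
  apply LinearMap.ext
  intro g
  rw [Module.End.mul_apply, Module.End.mul_apply, Module.End.mul_apply, mulOp_apply, mulOp_apply]
  exact chi_smul_eq_self Ω fun x hx => bOp_chi_apply_eq_zero C Ω A hK hK₀ hK₀8 hN3 hΩ hmsq hak j g hx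

/-- `a_j(1_Ωg)` is supported in `Ω` (its output is `h_j·G_j(h_j1_Ωg)`, supported in the piece). [cite: Balaban1983RegularityDecay, (2.2) p.575] -/
theorem aOp_chi_apply_eq_zero (hK : K ≤ P.K) (hK₀ : K₀ ∣ P.M) (hK₀8 : 8 ≤ K₀) (hN3 : ∀ μ, 3 * half P K K₀ ≤ P.sitesPerDir 0 μ)
    (hΩ : ∀ x x' : HiggsLattice.Site P 0, blockIter K x = blockIter K x' → (x ∈ Ω ↔ x' ∈ Ω))
    (hmsq : 0 < msq) (hak : 0 ≤ B1.aSeq a P.L K) (j : Lab P K K₀) (g : ScalarField P 0 N)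
    {x : HiggsLattice.Site P 0} (hx : x ∉ Ω) :
    aOp C K K₀ Ω A msq a j (chi Ω • g) x = 0 := by
  have hK₀' : 1 ≤ K₀ := le_trans (by norm_num) hK₀8
  have hP := piece_blockSat hK hK₀ hK₀' hN3 hΩ j
  have hvsupp : ∀ y, y ∉ piece K K₀ Ω j → Gloc C K K₀ Ω A msq a j (hTor K K₀ j • (chi Ω • g)) y = 0 :=
    propagatorK_supported C (piece K K₀ Ω j) (fld K K₀ Ω A j) hmsq hak hP (hTor K K₀ j • (chi Ω • g))
      (hTor_smul_supported_piece hK hK₀ hK₀8 Ω j _ (chi_smul_supported Ω g))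
  rw [aOp_apply, Pi.smul_apply', hvsupp x (fun h => hx (piece_subset Ω j h)), smul_zero]

/-- **`1_Ω·R·1_Ω = R·1_Ω`**. [cite: Balaban1983RegularityDecay, (2.11) p.576] -/
theorem mulOp_chi_Rop (hK : K ≤ P.K) (hK₀ : K₀ ∣ P.M) (hK₀8 : 8 ≤ K₀) (hN3 : ∀ μ, 3 * half P K K₀ ≤ P.sitesPerDir 0 μ)
    (hΩ : ∀ x x' : HiggsLattice.Site P 0, blockIter K x = blockIter K x' → (x ∈ Ω ↔ x' ∈ Ω))
    (hmsq : 0 < msq) (hak : 0 ≤ B1.aSeq a P.L K) :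
    mulOp (N := N) (chi Ω) * Rop C K K₀ Ω A msq a * mulOp (N := N) (chi Ω)
      = Rop C K K₀ Ω A msq a * mulOp (N := N) (chi Ω) := by
  unfold Rop
  rw [Finset.mul_sum, Finset.sum_mul, Finset.sum_mul]
  exact Finset.sum_congr rfl fun j _ => mulOp_chi_bOp C Ω A hK hK₀ hK₀8 hN3 hΩ hmsq hak j

end Support

/-! ## §3 The identity (2.12) for the projected system and the locality (2.13) -/

section Identity

variable (C : ChargeData N) {K K₀ : ℕ} (Ω : Finset (HiggsLattice.Site P 0)) (A : HiggsLattice.VecField P 0) {msq a : ℝ}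

/-- **(2.12) ON `Ω`: `G·1_Ω = G₀·1_Ω + (G·1_Ω)(R·1_Ω)`** (`Ω` a union of `K`-blocks, `m² > 0`, `a_K ≥ 0`, `K ≤ K_P`, `K₀ ∣ M_P`, `K₀ ≥ 8`,
`3M ≤ |T_ε|_μ`) — the hypothesis `hG` of the walk expansion for the region. [cite: Balaban1983RegularityDecay, (2.12) p.577] -/
theorem GP_eq (hK : K ≤ P.K) (hK₀ : K₀ ∣ P.M) (hK₀8 : 8 ≤ K₀) (hN3 : ∀ μ, 3 * half P K K₀ ≤ P.sitesPerDir 0 μ)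
    (hΩ : ∀ x x' : HiggsLattice.Site P 0, blockIter K x = blockIter K x' → (x ∈ Ω ↔ x' ∈ Ω))
    (hmsq : 0 < msq) (hak : 0 ≤ B1.aSeq a P.L K) :
    GP C K Ω A msq a = G0P C K K₀ Ω A msq a + GP C K Ω A msq a * RopP C K K₀ Ω A msq a := by
  unfold GP G0P RopP
  have h := propagatorK_eq_G0_add (C := C) (K₀ := K₀) Ω A msq a hK hK₀ hK₀8 hmsq hak
  calc propagatorK C Ω A msq a K * mulOp (N := N) (chi Ω)
      = (G0 C K K₀ Ω A msq a + propagatorK C Ω A msq a K * Rop C K K₀ Ω A msq a) * mulOp (N := N) (chi Ω) := by rw [← h]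
    _ = G0 C K K₀ Ω A msq a * mulOp (N := N) (chi Ω)
        + propagatorK C Ω A msq a K * (mulOp (N := N) (chi Ω) * Rop C K K₀ Ω A msq a * mulOp (N := N) (chi Ω)) := by
        rw [mulOp_chi_Rop C Ω A hK hK₀ hK₀8 hN3 hΩ hmsq hak, add_mul, mul_assoc]
    _ = G0 C K K₀ Ω A msq a * mulOp (N := N) (chi Ω)
        + propagatorK C Ω A msq a K * mulOp (N := N) (chi Ω) * (Rop C K K₀ Ω A msq a * mulOp (N := N) (chi Ω)) := by
        simp only [mul_assoc]

/-- **LOCALITY (2.13) FOR THE PROJECTED LETTERS**: `(a_i1_Ω)(b_l1_Ω) = 0` for labels with disjoint `rS`-cores.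
[cite: Balaban1983RegularityDecay, (2.13) p.577] -/
theorem aOpP_mul_bOpP_eq_zero (hK : K ≤ P.K) (hK₀ : K₀ ∣ P.M) (hK₀8 : 8 ≤ K₀) (hN3 : ∀ μ, 3 * half P K K₀ ≤ P.sitesPerDir 0 μ)
    (hΩ : ∀ x x' : HiggsLattice.Site P 0, blockIter K x = blockIter K x' → (x ∈ Ω ↔ x' ∈ Ω))
    (hmsq : 0 < msq) (hak : 0 ≤ B1.aSeq a P.L K) (i l : Lab P K K₀)
    (h : ∀ x : HiggsLattice.Site P 0, ¬ (Near K K₀ (rS P K K₀) i x ∧ Near K K₀ (rS P K K₀) l x)) :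
    aOpP C K K₀ Ω A msq a i * bOpP C K K₀ Ω A msq a l = 0 := by
  unfold aOpP bOpP
  rw [mul_assoc, ← mul_assoc (mulOp (N := N) (chi Ω)), mulOp_chi_bOp C Ω A hK hK₀ hK₀8 hN3 hΩ hmsq hak l, ← mul_assoc,
    aOp_mul_bOp_eq_zero C Ω A msq a hK hK₀ hK₀8 i l h, zero_mul]

/-- **LOCALITY (2.13)**: `(b_i1_Ω)(b_l1_Ω) = 0` for labels with disjoint `rS`-cores. [cite: Balaban1983RegularityDecay, (2.13) p.577] -/
theorem bOpP_mul_bOpP_eq_zero (hK : K ≤ P.K) (hK₀ : K₀ ∣ P.M) (hK₀8 : 8 ≤ K₀) (hN3 : ∀ μ, 3 * half P K K₀ ≤ P.sitesPerDir 0 μ)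
    (hΩ : ∀ x x' : HiggsLattice.Site P 0, blockIter K x = blockIter K x' → (x ∈ Ω ↔ x' ∈ Ω))
    (hmsq : 0 < msq) (hak : 0 ≤ B1.aSeq a P.L K) (i l : Lab P K K₀)
    (h : ∀ x : HiggsLattice.Site P 0, ¬ (Near K K₀ (rS P K K₀) i x ∧ Near K K₀ (rS P K K₀) l x)) :
    bOpP C K K₀ Ω A msq a i * bOpP C K K₀ Ω A msq a l = 0 := by
  unfold bOpP
  rw [mul_assoc, ← mul_assoc (mulOp (N := N) (chi Ω)), mulOp_chi_bOp C Ω A hK hK₀ hK₀8 hN3 hΩ hmsq hak l, ← mul_assoc,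
    bOp_mul_bOp_eq_zero C Ω A msq a hK hK₀ hK₀8 i l h, zero_mul]

end Identity

/-! ## §4 The `L²` smallness of `R` on `Ω` and the Neumann tail -/

section L2

variable (C : ChargeData N) {K K₀ : ℕ} (Ω : Finset (HiggsLattice.Site P 0)) (A : HiggsLattice.VecField P 0) {msq a : ℝ}

/-- Cauchy–Schwarz: `‖Σ_{j ∈ s} v_j‖² ≤ |s|·Σ_{j ∈ s}‖v_j‖²`. [folklore] -/
private theorem norm_sq_sum_le_card_mul {ι : Type*} (s : Finset ι) (v : ι → EuclideanSpace ℝ (Fin N)) :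
    ‖∑ j ∈ s, v j‖ ^ 2 ≤ s.card * ∑ j ∈ s, ‖v j‖ ^ 2 :=
  calc ‖∑ j ∈ s, v j‖ ^ 2 ≤ (∑ j ∈ s, ‖v j‖) ^ 2 := pow_le_pow_left₀ (norm_nonneg _) (norm_sum_le _ _) 2
    _ ≤ s.card * ∑ j ∈ s, ‖v j‖ ^ 2 := sq_sum_le_card_mul_sum_sq

/-- **THE LETTER READS ITS INPUT ON THE CORE ONLY**: `b_jψ = b_j(1_{|·−Mj| ≤ rS}ψ)`. [cite: Balaban1983RegularityDecay, (2.13) p.577] -/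
theorem bOp_eq_bOp_nearCut (hK : K ≤ P.K) (hK₀ : K₀ ∣ P.M) (hK₀8 : 8 ≤ K₀) (j : Lab P K K₀) (ψ : ScalarField P 0 N) :
    bOp C K K₀ Ω A msq a j ψ
      = bOp C K K₀ Ω A msq a j ((fun x => if Near K K₀ (rS P K K₀) j x then (1 : ℝ) else 0) • ψ) := by
  rw [← sub_eq_zero, ← map_sub]
  refine bOp_apply_eq_zero_of C Ω A msq a hK hK₀ hK₀8 j _ fun x hx => ?_
  rw [Pi.sub_apply, Pi.smul_apply', if_pos hx, one_smul, sub_self]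

/-- **«THE L₂-NORM OF R IS SMALL FOR M LARGE»** on `Ω`: if every letter satisfies `‖b_jφ‖₂ ≤ β‖φ‖₂` for `Ω`-supported `φ`, then
`‖Rφ‖₂ ≤ 2^d·β·‖φ‖₂` for `Ω`-supported `φ` — at each site at most `2^d` letters contribute (output cores) and each site feeds at most `2^d`
letters (input cores). [cite: Balaban1983RegularityDecay, p.577 «the L₂-norm of the operator R … is small for M large enough»] -/
theorem sNorm_Rop_le (hK : K ≤ P.K) (hK₀ : K₀ ∣ P.M) (hK₀8 : 8 ≤ K₀) {β : ℝ} (hβ : 0 ≤ β)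
    (hb : ∀ (j : Lab P K K₀) (φ : ScalarField P 0 N), (∀ x, x ∉ Ω → φ x = 0) →
      sNorm (bOp C K K₀ Ω A msq a j φ) ≤ β * sNorm φ)
    (φ : ScalarField P 0 N) (hφ : ∀ x, x ∉ Ω → φ x = 0) :
    sNorm (Rop C K K₀ Ω A msq a φ) ≤ 2 ^ P.d * β * sNorm φ := by
  classical
  have hm : 0 ≤ P.mesh 0 ^ P.d := pow_nonneg (P.mesh_pos 0).le _
  set J : HiggsLattice.Site P 0 → Finset (Lab P K K₀) := fun x => Finset.univ.filter fun j => Near K K₀ (rS P K K₀) j x with hJ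
  have hJcard : ∀ x, ((J x).card : ℝ) ≤ 2 ^ P.d := fun x => by exact_mod_cast card_filter_near_rS_le hK hK₀ hK₀8 x
  -- the output cores: at `x` only the letters with `x` in their core contribute
  have hpt : ∀ x, ‖Rop C K K₀ Ω A msq a φ x‖ ^ 2 ≤ 2 ^ P.d * ∑ j : Lab P K K₀, ‖bOp C K K₀ Ω A msq a j φ x‖ ^ 2 := by
    intro x
    have hsum : Rop C K K₀ Ω A msq a φ x = ∑ j ∈ J x, bOp C K K₀ Ω A msq a j φ x := by
      rw [Rop_apply, Finset.sum_apply]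
      exact (Finset.sum_subset (Finset.subset_univ (J x)) fun j _ hj => bOp_apply_eq_zero_off C Ω A msq a hK hK₀ hK₀8 j φ
        (fun h => hj (by rw [hJ, Finset.mem_filter]; exact ⟨Finset.mem_univ _, h⟩))).symm
    rw [hsum]
    calc ‖∑ j ∈ J x, bOp C K K₀ Ω A msq a j φ x‖ ^ 2 ≤ (J x).card * ∑ j ∈ J x, ‖bOp C K K₀ Ω A msq a j φ x‖ ^ 2 :=
          norm_sq_sum_le_card_mul _ _
      _ ≤ 2 ^ P.d * ∑ j : Lab P K K₀, ‖bOp C K K₀ Ω A msq a j φ x‖ ^ 2 :=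
          mul_le_mul (hJcard x) (Finset.sum_le_univ_sum_of_nonneg fun j => sq_nonneg _) (Finset.sum_nonneg fun j _ => sq_nonneg _)
            (by positivity)
  -- the input cores: each letter is bounded by the norm of `φ` on its core
  have hletter : ∀ j : Lab P K K₀, ∑ x : HiggsLattice.Site P 0, P.mesh 0 ^ P.d * ‖bOp C K K₀ Ω A msq a j φ x‖ ^ 2
      ≤ β ^ 2 * ∑ x : HiggsLattice.Site P 0, P.mesh 0 ^ P.d * (if Near K K₀ (rS P K K₀) j x then ‖φ x‖ ^ 2 else 0) := by
    intro j
    set φj : ScalarField P 0 N := (fun x => if Near K K₀ (rS P K K₀) j x then (1 : ℝ) else 0) • φ with hφj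
    have hφjΩ : ∀ x, x ∉ Ω → φj x = 0 := fun x hx => by rw [hφj, Pi.smul_apply', hφ x hx, smul_zero]
    have hbj := hb j φj hφjΩ
    have e1 : ∑ x : HiggsLattice.Site P 0, P.mesh 0 ^ P.d * ‖bOp C K K₀ Ω A msq a j φ x‖ ^ 2 = sNorm (bOp C K K₀ Ω A msq a j φj) ^ 2 := by
      rw [sNorm_sq, siteInner_self_eq, ← bOp_eq_bOp_nearCut C Ω A hK hK₀ hK₀8 j φ]
    have e2 : ∑ x : HiggsLattice.Site P 0, P.mesh 0 ^ P.d * (if Near K K₀ (rS P K K₀) j x then ‖φ x‖ ^ 2 else 0) = sNorm φj ^ 2 := by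
      rw [sNorm_sq, siteInner_self_eq]
      refine Finset.sum_congr rfl fun x _ => ?_
      rw [hφj, Pi.smul_apply']
      split_ifs <;> simp
    rw [e1, e2]
    calc sNorm (bOp C K K₀ Ω A msq a j φj) ^ 2 ≤ (β * sNorm φj) ^ 2 := pow_le_pow_left₀ (sNorm_nonneg _) hbj 2
      _ = β ^ 2 * sNorm φj ^ 2 := by ring
  -- each site lies in at most `2^d` input cores
  have hinput : ∑ j : Lab P K K₀, ∑ x : HiggsLattice.Site P 0, P.mesh 0 ^ P.d * (if Near K K₀ (rS P K K₀) j x then ‖φ x‖ ^ 2 else 0)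
      ≤ 2 ^ P.d * ∑ x : HiggsLattice.Site P 0, P.mesh 0 ^ P.d * ‖φ x‖ ^ 2 := by
    rw [Finset.sum_comm, Finset.mul_sum]
    refine Finset.sum_le_sum fun x _ => ?_
    have e : ∑ j : Lab P K K₀, P.mesh 0 ^ P.d * (if Near K K₀ (rS P K K₀) j x then ‖φ x‖ ^ 2 else 0)
        = (J x).card * (P.mesh 0 ^ P.d * ‖φ x‖ ^ 2) := by
      rw [hJ, Finset.card_filter, Nat.cast_sum, Finset.sum_mul]
      refine Finset.sum_congr rfl fun j _ => ?_
      split_ifs <;> simp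
    rw [e]
    calc ((J x).card : ℝ) * (P.mesh 0 ^ P.d * ‖φ x‖ ^ 2) ≤ 2 ^ P.d * (P.mesh 0 ^ P.d * ‖φ x‖ ^ 2) :=
          mul_le_mul_of_nonneg_right (hJcard x) (by positivity)
      _ = _ := rfl
  -- assemble
  have htot : ∑ x : HiggsLattice.Site P 0, P.mesh 0 ^ P.d * ‖Rop C K K₀ Ω A msq a φ x‖ ^ 2 ≤ (2 ^ P.d * β) ^ 2 * siteInner φ φ := by
    calc ∑ x : HiggsLattice.Site P 0, P.mesh 0 ^ P.d * ‖Rop C K K₀ Ω A msq a φ x‖ ^ 2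
        ≤ ∑ x : HiggsLattice.Site P 0, P.mesh 0 ^ P.d * (2 ^ P.d * ∑ j : Lab P K K₀, ‖bOp C K K₀ Ω A msq a j φ x‖ ^ 2) :=
          Finset.sum_le_sum fun x _ => mul_le_mul_of_nonneg_left (hpt x) hm
      _ = 2 ^ P.d * ∑ j : Lab P K K₀, ∑ x : HiggsLattice.Site P 0, P.mesh 0 ^ P.d * ‖bOp C K K₀ Ω A msq a j φ x‖ ^ 2 := by
          rw [Finset.sum_comm, Finset.mul_sum]
          refine Finset.sum_congr rfl fun x _ => ?_
          rw [Finset.mul_sum, Finset.mul_sum, Finset.mul_sum]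
          exact Finset.sum_congr rfl fun j _ => by ring
      _ ≤ 2 ^ P.d * ∑ j : Lab P K K₀, (β ^ 2 * ∑ x : HiggsLattice.Site P 0, P.mesh 0 ^ P.d *
            (if Near K K₀ (rS P K K₀) j x then ‖φ x‖ ^ 2 else 0)) :=
          mul_le_mul_of_nonneg_left (Finset.sum_le_sum fun j _ => hletter j) (by positivity)
      _ = 2 ^ P.d * β ^ 2 * ∑ j : Lab P K K₀, ∑ x : HiggsLattice.Site P 0, P.mesh 0 ^ P.d *
            (if Near K K₀ (rS P K K₀) j x then ‖φ x‖ ^ 2 else 0) := by rw [← Finset.mul_sum]; ring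
      _ ≤ 2 ^ P.d * β ^ 2 * (2 ^ P.d * ∑ x : HiggsLattice.Site P 0, P.mesh 0 ^ P.d * ‖φ x‖ ^ 2) :=
          mul_le_mul_of_nonneg_left hinput (by positivity)
      _ = (2 ^ P.d * β) ^ 2 * siteInner φ φ := by rw [siteInner_self_eq]; ring
  have h := sNorm_le_sqrt htot
  rwa [Real.sqrt_mul (sq_nonneg _), Real.sqrt_sq (by positivity), ← sNorm_sq, Real.sqrt_sq (sNorm_nonneg φ)] at h

/-- `‖(R·1_Ω)g‖₂ ≤ 2^dβ‖g‖₂` for every `g`. [cite: Balaban1983RegularityDecay, p.577] -/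
theorem sNorm_RopP_le (hK : K ≤ P.K) (hK₀ : K₀ ∣ P.M) (hK₀8 : 8 ≤ K₀) {β : ℝ} (hβ : 0 ≤ β)
    (hb : ∀ (j : Lab P K K₀) (φ : ScalarField P 0 N), (∀ x, x ∉ Ω → φ x = 0) →
      sNorm (bOp C K K₀ Ω A msq a j φ) ≤ β * sNorm φ)
    (g : ScalarField P 0 N) : sNorm (RopP C K K₀ Ω A msq a g) ≤ 2 ^ P.d * β * sNorm g := by
  rw [RopP_apply]
  exact (sNorm_Rop_le C Ω A hK hK₀ hK₀8 hβ hb _ (chi_smul_supported Ω g)).trans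
    (mul_le_mul_of_nonneg_left (sNorm_chi_smul_le Ω g) (by positivity))

/-- **THE NEUMANN SERIES CONTRACTS IN `L²`**: `‖(R·1_Ω)^m g‖₂ ≤ (2^dβ)^m‖g‖₂`. [cite: Balaban1983RegularityDecay, (2.12) p.577] -/
theorem sNorm_RopP_pow_le (hK : K ≤ P.K) (hK₀ : K₀ ∣ P.M) (hK₀8 : 8 ≤ K₀) {β : ℝ} (hβ : 0 ≤ β)
    (hb : ∀ (j : Lab P K K₀) (φ : ScalarField P 0 N), (∀ x, x ∉ Ω → φ x = 0) →
      sNorm (bOp C K K₀ Ω A msq a j φ) ≤ β * sNorm φ) :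
    ∀ (m : ℕ) (g : ScalarField P 0 N), sNorm ((RopP C K K₀ Ω A msq a ^ m) g) ≤ (2 ^ P.d * β) ^ m * sNorm g
  | 0, g => by simp
  | m + 1, g => by
    rw [pow_succ, Module.End.mul_apply, pow_succ]
    calc sNorm ((RopP C K K₀ Ω A msq a ^ m) (RopP C K K₀ Ω A msq a g))
        ≤ (2 ^ P.d * β) ^ m * sNorm (RopP C K K₀ Ω A msq a g) := sNorm_RopP_pow_le hK hK₀ hK₀8 hβ hb m _
      _ ≤ (2 ^ P.d * β) ^ m * (2 ^ P.d * β * sNorm g) :=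
          mul_le_mul_of_nonneg_left (sNorm_RopP_le C Ω A hK hK₀ hK₀8 hβ hb g) (by positivity)
      _ = (2 ^ P.d * β) ^ m * (2 ^ P.d * β) * sNorm g := by ring

/-- **THE TAIL OF (2.12) AT A SITE**: `|((G·1_Ω)(R·1_Ω)^m g)(x)| ≤ ε^{−d/2}·m⁻²·(2^dβ)^m·‖g‖₂` (`m² > 0`, `a_K ≥ 0`).
[cite: Balaban1983RegularityDecay, (2.12) p.577] [cite: Balaban1982Higgs1, (2.20) p.610] -/
theorem norm_GP_RopP_pow_apply_le (hK : K ≤ P.K) (hK₀ : K₀ ∣ P.M) (hK₀8 : 8 ≤ K₀) (hmsq : 0 < msq) (hak : 0 ≤ B1.aSeq a P.L K)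
    {β : ℝ} (hβ : 0 ≤ β)
    (hb : ∀ (j : Lab P K K₀) (φ : ScalarField P 0 N), (∀ x, x ∉ Ω → φ x = 0) →
      sNorm (bOp C K K₀ Ω A msq a j φ) ≤ β * sNorm φ)
    (m : ℕ) (g : ScalarField P 0 N) (x : HiggsLattice.Site P 0) :
    ‖(GP C K Ω A msq a * RopP C K K₀ Ω A msq a ^ m) g x‖
      ≤ (Real.sqrt (P.mesh 0 ^ P.d))⁻¹ * msq⁻¹ * ((2 ^ P.d * β) ^ m * sNorm g) := by
  have hs : 0 < Real.sqrt (P.mesh 0 ^ P.d) := Real.sqrt_pos.2 (pow_pos (P.mesh_pos 0) _)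
  rw [Module.End.mul_apply, GP_apply]
  set w := chi Ω • (RopP C K K₀ Ω A msq a ^ m) g with hw
  have h1 : Real.sqrt (P.mesh 0 ^ P.d) * ‖propagatorK C Ω A msq a K w x‖ ≤ sNorm (propagatorK C Ω A msq a K w) :=
    sqrt_mul_norm_apply_le _ x
  have h2 : msq * sNorm (propagatorK C Ω A msq a K w) ≤ sNorm w := msq_mul_sNorm_propagatorK_le C Ω A hmsq a K hak w
  have h3 : sNorm w ≤ (2 ^ P.d * β) ^ m * sNorm g :=
    (sNorm_chi_smul_le Ω _).trans (sNorm_RopP_pow_le C Ω A hK hK₀ hK₀8 hβ hb m g)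
  calc ‖propagatorK C Ω A msq a K w x‖
      = (Real.sqrt (P.mesh 0 ^ P.d))⁻¹ * (Real.sqrt (P.mesh 0 ^ P.d) * ‖propagatorK C Ω A msq a K w x‖) := by
        field_simp
    _ ≤ (Real.sqrt (P.mesh 0 ^ P.d))⁻¹ * sNorm (propagatorK C Ω A msq a K w) :=
        mul_le_mul_of_nonneg_left h1 (inv_nonneg.2 hs.le)
    _ = (Real.sqrt (P.mesh 0 ^ P.d))⁻¹ * msq⁻¹ * (msq * sNorm (propagatorK C Ω A msq a K w)) := by
        field_simp
    _ ≤ (Real.sqrt (P.mesh 0 ^ P.d))⁻¹ * msq⁻¹ * sNorm w :=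
        mul_le_mul_of_nonneg_left h2 (mul_nonneg (inv_nonneg.2 hs.le) (inv_nonneg.2 hmsq.le))
    _ ≤ (Real.sqrt (P.mesh 0 ^ P.d))⁻¹ * msq⁻¹ * ((2 ^ P.d * β) ^ m * sNorm g) :=
        mul_le_mul_of_nonneg_left h3 (mul_nonneg (inv_nonneg.2 hs.le) (inv_nonneg.2 hmsq.le))

/-- **THE REMAINDER OF (2.12) TENDS TO ZERO** when `2^dβ < 1`: for every `ε′ > 0` some power `m` has `|((G·1_Ω)(R·1_Ω)^m g)(x)| ≤ ε′` — the
hypothesis `hrem` of r01's `B4Ineq110LpChain.lp_walk_bound_rem_exp` for the region. [cite: Balaban1983RegularityDecay, (2.12) p.577, (2.22) p.579] -/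
theorem exists_tail_le (hK : K ≤ P.K) (hK₀ : K₀ ∣ P.M) (hK₀8 : 8 ≤ K₀) (hmsq : 0 < msq) (hak : 0 ≤ B1.aSeq a P.L K)
    {β : ℝ} (hβ : 0 ≤ β) (hsmall : 2 ^ P.d * β < 1)
    (hb : ∀ (j : Lab P K K₀) (φ : ScalarField P 0 N), (∀ x, x ∉ Ω → φ x = 0) →
      sNorm (bOp C K K₀ Ω A msq a j φ) ≤ β * sNorm φ)
    (g : ScalarField P 0 N) (x : HiggsLattice.Site P 0) :
    ∀ ε' : ℝ, 0 < ε' → ∃ m : ℕ, ‖(GP C K Ω A msq a * RopP C K K₀ Ω A msq a ^ m) g x‖ ≤ ε' := by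
  intro ε' hε'
  set Cst : ℝ := (Real.sqrt (P.mesh 0 ^ P.d))⁻¹ * msq⁻¹ * sNorm g with hCst
  have hC0 : 0 ≤ Cst := by
    have := Real.sqrt_nonneg (P.mesh 0 ^ P.d)
    have := sNorm_nonneg g
    positivity
  by_cases hC : Cst = 0
  · refine ⟨0, ?_⟩
    have h := norm_GP_RopP_pow_apply_le C Ω A hK hK₀ hK₀8 hmsq hak hβ hb 0 g x
    have e : (Real.sqrt (P.mesh 0 ^ P.d))⁻¹ * msq⁻¹ * ((2 ^ P.d * β) ^ 0 * sNorm g) = Cst := by rw [hCst]; ring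
    rw [e, hC] at h
    exact h.trans hε'.le
  · have hCpos : 0 < Cst := lt_of_le_of_ne hC0 (Ne.symm hC)
    obtain ⟨m, hm⟩ := exists_pow_lt_of_lt_one (div_pos hε' hCpos) hsmall
    refine ⟨m, ?_⟩
    have h := norm_GP_RopP_pow_apply_le C Ω A hK hK₀ hK₀8 hmsq hak hβ hb m g x
    have e : (Real.sqrt (P.mesh 0 ^ P.d))⁻¹ * msq⁻¹ * ((2 ^ P.d * β) ^ m * sNorm g) = (2 ^ P.d * β) ^ m * Cst := by
      rw [hCst]; ring
    rw [e] at h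
    refine h.trans ?_
    have := (lt_div_iff₀ hCpos).1 hm
    linarith

end L2

end Literature.MathematicalPhysics.QuantumFieldTheory.Balaban1983to89.B1TorusRegionRop

end
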